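import Literature.Probability.Percolation.NearCriticalFiniteClusterDecay
import Literature.Probability.Percolation.NearCriticalArm
import Mathlib.Data.Nat.Log
import HarnessLib

/-!
# Nolin's uniform exponential decay beyond `L_ε` (Lemma 39) from RSW and a block argument

Topic `Literature/Probability/Percolation`; family `crit-perc`. Part of the bottom-up discharge of
`Literature.Probability.Percolation.triCorrLength_exponent` (`ArmExponents.lean`; decomposition in
`NearCriticalCorrelationLength.lean`, `NearCriticalCorrelationLengthLower.lean`,
`NearCriticalFiniteClusterDecay.lean`). This file PROVES the named fact `Nolin2008_lemma39_at ε`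
(Nolin 2008, Lemma 39 with Remark 40; EJP numbering, = Lemma 37 / Remark 38 of arXiv 0711.4948): for `p < 1/2`,
`P_p(𝒞_H([0, n] × [0, k n])) ≤ C₁ e^{-C₂ n / L_ε(p)}`) for every `ε` below a threshold `ε₀ > 0`
given by the Russo–Seymour–Welsh theorem — exactly the range in which Nolin proves it directly
("Hence, we have proved the property for any `ε` below some fixed value `ε₀` (given by RSW)"; the
extension to all `ε ∈ (0, 1/2)` uses `L_ε ≍ L_{ε'}`, his Cor. 37, and is not needed: one value of
`ε` suffices for `triCorrLength_exponent`, see `triCorrLength_exponent_of_RSW_lemma39_at'`).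

## The printed proof and its transcription

Nolin 2008, §7.4, proof of Lemma 39, quoted from arXiv 0711.4948 (where it is Lemma 37, and
the RSW theorem referred to is Theorem 2):

"We use a block argument: for each integer `n`,
`P_p(𝒞_H([0, 2n] × [0, 4n])) ≤ C' [P_p(𝒞_H([0, n] × [0, 2n]))]²` with `C' = 10²` some universal
constant. It suffices for that to divide the parallelogram `[0, 2n] × [0, 4n]` into 4 horizontal
sub-parallelograms `[0, 2n] × [i n, (i+1) n]` and 6 vertical ones `[i n, (i+1) n] × [j n, (j+2) n]`.
Indeed, consider a horizontal crossing of the big parallelogram: by considering its pieces in the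
two regions `0 < x < n` and `n < x < 2n`, we can extract from it two sub-paths crossing one of the
sub-parallelograms 'in the easy way'. They are disjoint by construction, so the claim follows by
using the BK inequality. We then obtain by iterating
`C' P_p(𝒞_H([0, 2^k L] × [0, 2^{k+1} L])) ≤ (C' ε₁)^{2^k}` as soon as
`ε₁ ≥ P_p(𝒞_H([0, L] × [0, 2L]))`. (…) The RSW theory thus entails (Theorem 2) that for all fixed
`ε₁ > 0`, we can take `ε₀` sufficiently small to get automatically (and independently of `p`)
that `P_p(𝒞_H([0, L] × [0, 2L])) ≤ ε₁`. We now choose `ε₁ = 1/(e² C')`. For each integer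
`n ≥ L(p)`, we can define `k = k(n)` such that `2^k ≤ n / L(p) < 2^{k+1}`, and then
`P_p(𝒞_H([0, n]²)) ≤ P_p(𝒞_H([0, 2^k L] × [0, 2^{k+1} L])) ≤ e^{-2^{k+1}} ≤ e × e^{-n/L(p)}`."

Transcription (site percolation on `𝕋`, tree events `triLRCrossing`, `triHCross`, `triVCross`):
* We avoid the BK inequality by making the two pieces live on DISJOINT sets of columns: the
  parallelogram of width `2w + 1` (columns `0, …, 2w+1`) is split into the columns `0, …, w` and
  `w+1, …, 2w+1`, each of width `w`; a left–right crossing contains a left–right crossing of each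
  piece (`PathIn.exists_slab_crossing`, `TriPathCrossings.lean`), and events determined by disjoint
  sets of sites are independent (`sitePercolation_real_inter_of_disjoint`). The recursion is thus
  on the widths `w ↦ 2w + 1` and on `a(w) = P_p(LR_𝕋(w, 3w))` (aspect ratio `3` instead of `2`).
* "sub-paths crossing one of the sub-parallelograms in the easy way" is the covering lemma
  `triHCross_subset_bands`: a left–right crossing of a piece `[c, c+w] × [0, H]` either stays in a
  window `[c, c+w] × [i(w+1) - w, i(w+1) + 2w]` of height `3w` around the band containing its
  starting point, or crosses vertically a `w × w` parallelogram just above or just below that band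
  (`PathIn.exists_slab_crossing`); there are `⌊H/(w+1)⌋ + 1` bands, so
  `P_p(piece crossed) ≤ 3 (⌊H/(w+1)⌋ + 1) a(w)` (`triSitePercolation_real_triHCross_le_bands`; `≤ 18 a(w)` for the
  height `H = 3(2w+1)` of the recursion), and `a(2w+1) ≤ (18 a(w))²` (`triLRCrossingProb_rec`).
* Iteration: `324 a(L) ≤ e^{-1}` gives `324 a(2^j (L+1) - 1) ≤ e^{-2^j}` (`sq_iter_le`, `324 = 18²`), and for
  `2^j (L+1) - 1 ≤ n < 2^{j+1} (L+1) - 1` the covering lemma and `2^j > n / (4L)` give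
  `P_p(LR_𝕋(n, k n)) ≤ (k + 2) e^{1/4} e^{-n/(4L)}` (`Nolin2008_lemma39_at_of_start`).
* The start `324 P_p(LR_𝕋(L, 3L)) ≤ e^{-1}` for `L = L_ε(p) ≥ 1`, `p < 1/2`, `ε ≤ ε₀`: by the
  definition of `L_ε`, `P_p(LR_𝕋(L, L)) ≤ ε`; by the Hex lemma and the meeting of crossings,
  `P_p(LR_𝕋(m, n)) + P_{1-p}(LR_𝕋(n, m)) = 1` (the tree's `triLRCrossingProb_add_eq_one`,
  `TriHexExclusive.lean`), so the closed sites cross the `L × L` rhombus with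
  probability `≥ 1 - ε ≥ δ₀`, hence (RSW, `Nolin2008_RSW_one` with `k = 3`) the `3L × L`
  parallelogram the long way with probability `≥ 1 - η`, hence `P_p(LR_𝕋(L, 3L)) ≤ η = e^{-1}/324`
  (`lemma39_start_of_RSW_one`).

Main results: `Nolin2008_lemma39_at_of_RSW_one : Nolin2008_RSW_one → ∃ ε₀ > 0, ∀ ε ≤ ε₀,
Nolin2008_lemma39_at ε`; the comparison `Nolin2008_lemma39_at_of_lemma39` with the tree's named
fact `Nolin2008_lemma39` (`NearCriticalArm.lean`: every `ε ∈ (0, 1/2)`, guard `ε < p`), whence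
`triCorrLength_exponent_of_RSW_lemma39 : fourArm_exponent → Nolin2008_prop34 → Nolin2008_RSW →
Nolin2008_lemma39 → triCorrLength_exponent`; and the assemblies
`triCorrLength_exponent_of_RSW_one : fourArm_exponent → Nolin2008_prop34 → Nolin2008_RSW →
Nolin2008_RSW_one → triCorrLength_exponent` and `triCorrLength_exponent_of_RSW_thm :
fourArm_exponent → Nolin2008_prop34 → Nolin2008_RSW_thm → triCorrLength_exponent` — the
correlation-length exponent `ν = 4/3` from the four-arm exponent (Smirnov–Werner 2001), Kesten's
scaling relation and the Russo–Seymour–Welsh theorem on `𝕋` (Nolin 2008, §3.1, RSW theorem [arXiv: Thm. 2]).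

## References

* P. Nolin, *Near-critical percolation in two dimensions*, Electron. J. Probab. 13 (2008), §3.1
  Theorem "Russo–Seymour–Welsh" (arXiv: Thm. 2), §7.4 Lemma 39 / Remark 40 (EJP numbering; arXiv
  0711.4948: Lemma 37 / Remark 38) [Nolin2008].
* H. Kesten, Scaling relations for 2D-percolation, *Comm. Math. Phys.* 109 (1987) (the original
  block argument, Lemma (2.24)); H. Kesten, *Percolation theory for mathematicians* (1982), §2.2.
* B. Bollobás, O. Riordan, *Percolation* (2006), Ch. 5, Lemma 7 (Hex lemma) [BollobasRiordan2006].

## Mathlib / tree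

Mathlib: `Nat.log`, `Nat.findGreatest`-free arithmetic (`Nat.div_lt_iff_lt_mul`,
`Nat.pow_log_le_self`, `Nat.lt_pow_succ_log_self`), `Real.exp`, `measureReal_biUnion_finset_le`,
`measureReal_union_le`. Tree: `triLRCrossingProb_add_eq_one` (`TriHexExclusive.lean`),
`PathIn.exists_slab_crossing(')`
(`TriPathCrossings.lean`), `triHCross`, `triVCross`, `triHCross_zero_zero`,
`triSitePercolation_real_triHCross/VCross`, `determinedBy_triHCross`, `triLRCrossing_anti_width`,
`PathIn.exists_support` (`TriRSWChaining.lean`), `triLRCrossingProb_mono_height`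
(`TriShiftedCrossings.lean`), `charLength`,
`triLRCrossingProb_charLength_le` (`KestenScaling.lean`), `Nolin2008_lemma39_at`
(`NearCriticalCorrelationLength.lean`), `Nolin2008_lemma39` (`NearCriticalArm.lean`),
`Nolin2008_RSW`, `Nolin2008_RSW_one` (`NearCriticalCorrelationLengthLower.lean`),
`triCorrLength_exponent_of_RSW_lemma39_at'` (`NearCriticalFiniteClusterDecay.lean`).
-/

noncomputable section

open MeasureTheory Set Filter Topology
open scoped unitInterval

namespace Literature.Probability.Percolation

open LatticeModels

/-! ### The covering of a piece by windows and squares ("crossing in the easy way") -/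

/-- **Covering lemma.** An open left–right crossing of the piece `[c, c+w] × [0, H]` either stays
inside the window `[c, c+w] × [i(w+1) - w, i(w+1) + 2w]` of height `3w` around the band
`[i(w+1), i(w+1) + w]` containing its starting point (`i ≤ H / (w+1)`), or contains an open
top–bottom crossing of the `w × w` parallelogram just above (`[c, c+w] × [i(w+1)+w+1, i(w+1)+2w+1]`)
or just below (`[c, c+w] × [i(w+1)-w, i(w+1)]`) that window's central part
(`PathIn.exists_slab_crossing`; Nolin 2008, proof of Lemma 39: "we can extract from it (…)
sub-paths crossing one of the sub-parallelograms in the easy way"). [cite: Nolin2008, §7.4 (proof of Lemma 39; arXiv: Lemma 37)] -/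
theorem triHCross_subset_bands {c : ℤ} {w H : ℕ} {ω : SiteConfig (Site 2)}
    (hω : ω ∈ triHCross c 0 w H) :
    ∃ i : ℕ, i ≤ H / (w + 1) ∧
      (ω ∈ triHCross c ((i : ℤ) * (w + 1) - w) w (3 * w) ∨
        ω ∈ triVCross c ((i : ℤ) * (w + 1) + w + 1) w w ∨
        ω ∈ triVCross c ((i : ℤ) * (w + 1) - w) w w) := by
  obtain ⟨x, y, hx, hy, hpath⟩ := hω
  obtain ⟨S, hSsub, hSxy, hS⟩ := hpath.exists_support
  have hSb : ∀ z ∈ S, (c ≤ z 0 ∧ z 0 ≤ c + w) ∧ ((0 : ℤ) ≤ z 1 ∧ z 1 ≤ H) ∧ z ∈ ω := fun z hz => by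
    obtain ⟨h1, h2⟩ := hSsub hz
    rw [mem_triStrip] at h1
    exact ⟨⟨h1.1, h1.2.1⟩, ⟨by linarith [h1.2.2.1], by linarith [h1.2.2.2]⟩, h2⟩
  have hx1 : (0 : ℤ) ≤ x 1 ∧ x 1 ≤ H := (hSb x hSxy.left_mem).2.1
  set i : ℕ := (x 1).toNat / (w + 1) with hi
  have hxnat : (((x 1).toNat : ℕ) : ℤ) = x 1 := Int.toNat_of_nonneg hx1.1
  have hi1 : (i : ℤ) * (w + 1) ≤ x 1 ∧ x 1 ≤ (i : ℤ) * (w + 1) + w := by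
    have h2 : i * (w + 1) ≤ (x 1).toNat := Nat.div_mul_le_self _ _
    have h3 : (x 1).toNat < i * (w + 1) + (w + 1) := Nat.lt_div_mul_add (Nat.succ_pos w)
    zify at h2 h3
    rw [hxnat] at h2 h3
    constructor <;> linarith
  refine ⟨i, ?_, ?_⟩
  · refine (Nat.le_div_iff_mul_le (Nat.succ_pos w)).2 ?_
    have h1 := hi1.1
    have h2 := hx1.2
    zify
    linarith
  · by_cases hwin : ∀ z ∈ S, (i : ℤ) * (w + 1) - w ≤ z 1 → z 1 ≤ (i : ℤ) * (w + 1) + 2 * w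
    · by_cases hwin' : ∀ z ∈ S, (i : ℤ) * (w + 1) - w ≤ z 1
      · -- the crossing stays in the window
        left
        refine ⟨x, y, hx, hy, hSxy.mono fun z hz => ?_⟩
        have hb := hSb z hz
        have hl := hwin' z hz
        have hu := hwin z hz hl
        refine ⟨?_, hb.2.2⟩
        simp only [mem_triStrip]
        push_cast
        refine ⟨hb.1.1, hb.1.2, hl, by linarith⟩
      · -- a site below the window: a downward crossing of the square below the band
        push Not at hwin'
        obtain ⟨s, hsS, hs⟩ := hwin'
        right; right
        obtain ⟨a', b', ha', hb', hq⟩ := (hS s hsS).exists_slab_crossing' 1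
          (L := (i : ℤ) * (w + 1) - w) (R := (i : ℤ) * (w + 1)) (by linarith) hi1.1 hs.le
        refine ⟨b', a', hb', by rw [ha']; ring, hq.symm.mono fun z hz => ?_⟩
        have hb := hSb z hz.1
        have hz2 := hz.2
        simp only [Set.mem_setOf_eq] at hz2
        refine ⟨?_, hb.2.2⟩
        simp only [mem_triStrip]
        exact ⟨hb.1.1, hb.1.2, hz2.1, by linarith [hz2.2]⟩
    · -- a site above the window: an upward crossing of the square above the band
      push Not at hwin
      obtain ⟨s, hsS, -, hs⟩ := hwin
      right; left
      obtain ⟨a', b', ha', hb', hq⟩ := (hS s hsS).exists_slab_crossing 1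
        (L := (i : ℤ) * (w + 1) + w + 1) (R := (i : ℤ) * (w + 1) + 2 * w + 1) (by linarith)
        (by linarith [hi1.2]) (by linarith)
      refine ⟨a', b', ha', by rw [hb']; ring, hq.mono fun z hz => ?_⟩
      have hb := hSb z hz.1
      have hz2 := hz.2
      simp only [Set.mem_setOf_eq] at hz2
      refine ⟨?_, hb.2.2⟩
      simp only [mem_triStrip]
      exact ⟨hb.1.1, hb.1.2, hz2.1, by linarith [hz2.2]⟩

/-- **Probability of crossing a piece** `[c, c+w] × [0, H]` from left to right: at most
`3 (⌊H/(w+1)⌋ + 1) A` whenever `P_p(LR_𝕋(w, 3w)) ≤ A` (union bound over the bands of the covering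
lemma; the squares are crossed with probability `P_p(LR_𝕋(w, w)) ≤ P_p(LR_𝕋(w, 3w))`). [cite: Nolin2008, §7.4 (proof of Lemma 39; arXiv: Lemma 37)] -/
theorem triSitePercolation_real_triHCross_le_bands (p : unitInterval) (c : ℤ) (w H : ℕ) {A : ℝ}
    (hA : triLRCrossingProb p w (3 * w) ≤ A) :
    (triSitePercolation p).real (triHCross c 0 w H) ≤ 3 * ((H / (w + 1) + 1 : ℕ) : ℝ) * A := by
  set E : ℕ → Set (SiteConfig (Site 2)) := fun i =>
    triHCross c ((i : ℤ) * (w + 1) - w) w (3 * w) ∪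
      (triVCross c ((i : ℤ) * (w + 1) + w + 1) w w ∪ triVCross c ((i : ℤ) * (w + 1) - w) w w)
    with hE
  have hcov : triHCross c 0 w H ⊆ ⋃ i ∈ Finset.range (H / (w + 1) + 1), E i := by
    intro ω hω
    obtain ⟨i, hi, h⟩ := triHCross_subset_bands hω
    refine Set.mem_iUnion₂.2 ⟨i, Finset.mem_range.2 (Nat.lt_succ_of_le hi), ?_⟩
    rcases h with h | h | h
    · exact Or.inl h
    · exact Or.inr (Or.inl h)
    · exact Or.inr (Or.inr h)
  have hsq : triLRCrossingProb p w w ≤ A :=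
    (triLRCrossingProb_mono_height p w (by omega : w ≤ 3 * w)).trans hA
  have hEi : ∀ i : ℕ, (triSitePercolation p).real (E i) ≤ 3 * A := fun i => by
    calc (triSitePercolation p).real (E i)
        ≤ (triSitePercolation p).real (triHCross c ((i : ℤ) * (w + 1) - w) w (3 * w)) +
            ((triSitePercolation p).real (triVCross c ((i : ℤ) * (w + 1) + w + 1) w w) +
              (triSitePercolation p).real (triVCross c ((i : ℤ) * (w + 1) - w) w w)) :=
          (measureReal_union_le _ _).trans (add_le_add le_rfl (measureReal_union_le _ _))
      _ ≤ A + (A + A) := by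
          rw [triSitePercolation_real_triHCross, triSitePercolation_real_triVCross,
            triSitePercolation_real_triVCross]
          exact add_le_add hA (add_le_add hsq hsq)
      _ = 3 * A := by ring
  calc (triSitePercolation p).real (triHCross c 0 w H)
      ≤ (triSitePercolation p).real (⋃ i ∈ Finset.range (H / (w + 1) + 1), E i) :=
        measureReal_mono hcov (measure_ne_top _ _)
    _ ≤ ∑ i ∈ Finset.range (H / (w + 1) + 1), (triSitePercolation p).real (E i) :=
        measureReal_biUnion_finset_le _ _
    _ ≤ ∑ _i ∈ Finset.range (H / (w + 1) + 1), 3 * A := Finset.sum_le_sum fun i _ => hEi i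
    _ = 3 * ((H / (w + 1) + 1 : ℕ) : ℝ) * A := by
        rw [Finset.sum_const, Finset.card_range, nsmul_eq_mul]; ring

/-! ### The block recursion on disjoint columns -/

/-- A left–right crossing of `[0, 2w+1] × [0, H]` contains left–right crossings of the two pieces
`[0, w] × [0, H]` and `[w+1, 2w+1] × [0, H]` (`PathIn.exists_slab_crossing`). [cite: Nolin2008, §7.4 (proof of Lemma 39; arXiv: Lemma 37)] -/
theorem triLRCrossing_subset_inter_pieces (w H : ℕ) :
    triLRCrossing (2 * w + 1) H ⊆ triHCross 0 0 w H ∩ triHCross ((w : ℤ) + 1) 0 w H := by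
  intro ω hω
  rw [← triHCross_zero_zero] at hω
  obtain ⟨x, y, hx, hy, hpath⟩ := hω
  have hyw : y 0 = 2 * (w : ℤ) + 1 := by rw [hy]; push_cast; ring
  have hsub : ∀ (L R : ℤ), ∀ z ∈ (triStrip 0 0 (2 * w + 1) H ∩ ω) ∩ {z : Site 2 | L ≤ z 0 ∧ z 0 ≤ R},
      R = L + w → z ∈ triStrip L 0 w H ∩ ω := by
    rintro L R z ⟨⟨hz, hzω⟩, hzc⟩ hRL
    simp only [Set.mem_setOf_eq] at hzc
    rw [mem_triStrip] at hz
    refine ⟨?_, hzω⟩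
    rw [mem_triStrip]
    exact ⟨hzc.1, by rw [← hRL]; exact hzc.2, hz.2.2.1, hz.2.2.2⟩
  constructor
  · obtain ⟨a', b', ha', hb', hq⟩ := hpath.exists_slab_crossing 0 (L := 0) (R := w)
      (by positivity) (by rw [hx]) (by rw [hyw]; linarith)
    exact ⟨a', b', ha', by rw [hb']; ring, hq.mono fun z hz => hsub 0 w z hz (by ring)⟩
  · obtain ⟨a', b', ha', hb', hq⟩ := hpath.exists_slab_crossing 0 (L := (w : ℤ) + 1)
      (R := 2 * (w : ℤ) + 1) (by linarith) (by rw [hx]; positivity) (by rw [hyw])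
    refine ⟨a', b', ha', by rw [hb']; ring, hq.mono fun z hz => hsub _ _ z hz (by ring)⟩

/-- The two pieces are determined by disjoint sets of sites, hence independent:
`P_p(both pieces crossed) = P_p(LR_𝕋 piece) ²` — no BK inequality needed. [folklore] -/
theorem triSitePercolation_real_inter_pieces (p : unitInterval) (w H : ℕ) :
    (triSitePercolation p).real (triHCross 0 0 w H ∩ triHCross ((w : ℤ) + 1) 0 w H) =
      (triSitePercolation p).real (triHCross 0 0 w H) *
        (triSitePercolation p).real (triHCross ((w : ℤ) + 1) 0 w H) := by
  have hdisj : Disjoint (triStripFinset 0 0 w H) (triStripFinset ((w : ℤ) + 1) 0 w H) := by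
    rw [Finset.disjoint_left]
    intro z h1 h2
    rw [← Finset.mem_coe, coe_triStripFinset, mem_triStrip] at h1 h2
    omega
  unfold triSitePercolation
  exact sitePercolation_real_inter_of_disjoint p (determinedBy_triHCross 0 0 w H)
    (determinedBy_triHCross _ 0 w H) hdisj

/-- **The block recursion** (Nolin 2008, proof of Lemma 39, first display, on disjoint columns and
with aspect ratio `3`): `a(2w+1) ≤ (18 a(w))²` for `a(w) = P_p(LR_𝕋(w, 3w))`: the parallelogram
`[0, 2w+1] × [0, 3(2w+1)]` is crossed only if both pieces are, independently, and each piece has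
`⌊(6w+3)/(w+1)⌋ + 1 ≤ 6` bands. [cite: Nolin2008, §7.4 (proof of Lemma 39 (arXiv: Lemma 37), block argument)] -/
theorem triLRCrossingProb_rec (p : unitInterval) (w : ℕ) :
    triLRCrossingProb p (2 * w + 1) (3 * (2 * w + 1)) ≤
      (18 * triLRCrossingProb p w (3 * w)) ^ 2 := by
  set A := triLRCrossingProb p w (3 * w) with hAdef
  set H := 3 * (2 * w + 1) with hH
  have hbands : ((H / (w + 1) + 1 : ℕ) : ℝ) ≤ 6 := by
    have : H / (w + 1) < 6 := (Nat.div_lt_iff_lt_mul (Nat.succ_pos w)).2 (by rw [hH]; omega)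
    exact_mod_cast (show H / (w + 1) + 1 ≤ 6 by omega)
  have hA0 : 0 ≤ A := measureReal_nonneg
  have hpiece : ∀ c : ℤ, (triSitePercolation p).real (triHCross c 0 w H) ≤ 18 * A := fun c =>
    calc (triSitePercolation p).real (triHCross c 0 w H) ≤ 3 * ((H / (w + 1) + 1 : ℕ) : ℝ) * A :=
          triSitePercolation_real_triHCross_le_bands p c w H le_rfl
      _ ≤ 3 * 6 * A := by gcongr
      _ = 18 * A := by ring
  calc triLRCrossingProb p (2 * w + 1) H
      ≤ (triSitePercolation p).real (triHCross 0 0 w H ∩ triHCross ((w : ℤ) + 1) 0 w H) :=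
        measureReal_mono (triLRCrossing_subset_inter_pieces w H) (measure_ne_top _ _)
    _ = (triSitePercolation p).real (triHCross 0 0 w H) *
          (triSitePercolation p).real (triHCross ((w : ℤ) + 1) 0 w H) := triSitePercolation_real_inter_pieces p w H
    _ ≤ (18 * A) * (18 * A) :=
        mul_le_mul (hpiece 0) (hpiece _) measureReal_nonneg (by positivity)
    _ = (18 * A) ^ 2 := by ring

/-! ### Iterating the recursion -/

/-- **Squaring iteration**: if `0 ≤ b`, `b(2n+1) ≤ b(n)²` and `b(n₀) ≤ e^{-1}`, then
`b(2^j (n₀+1) - 1) ≤ e^{-2^j}` (Nolin 2008, proof of Lemma 39, second display). [cite: Nolin2008, §7.4 (proof of Lemma 39 (arXiv: Lemma 37), iteration)] -/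
theorem sq_iter_le {b : ℕ → ℝ} (hb0 : ∀ n, 0 ≤ b n) (hrec : ∀ n, b (2 * n + 1) ≤ b n ^ 2)
    {n₀ : ℕ} (hstart : b n₀ ≤ Real.exp (-1)) (j : ℕ) :
    b (2 ^ j * (n₀ + 1) - 1) ≤ Real.exp (-2 ^ j) := by
  induction j with
  | zero => simpa using hstart
  | succ j ih =>
    have h1 : 1 ≤ 2 ^ j * (n₀ + 1) := Nat.one_le_iff_ne_zero.2 (by positivity)
    have hn : 2 ^ (j + 1) * (n₀ + 1) - 1 = 2 * (2 ^ j * (n₀ + 1) - 1) + 1 := by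
      have : 2 ^ (j + 1) * (n₀ + 1) = 2 * (2 ^ j * (n₀ + 1)) := by ring
      omega
    rw [hn]
    calc b (2 * (2 ^ j * (n₀ + 1) - 1) + 1) ≤ b (2 ^ j * (n₀ + 1) - 1) ^ 2 := hrec _
      _ ≤ Real.exp (-2 ^ j) ^ 2 := pow_le_pow_left₀ (hb0 _) ih 2
      _ = Real.exp (-2 ^ (j + 1)) := by rw [← Real.exp_nat_mul]; congr 1; push_cast; ring

/-- The scales `n_j = 2^j (n₀ + 1) - 1` exhaust `[n₀, ∞)`: every `n ≥ n₀` satisfies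
`n_j ≤ n < n_{j+1}` for `j = log₂ ((n+1)/(n₀+1))`, and then `n + 1 < 2^{j+1} (n₀+1)`. [folklore] -/
theorem exists_scale_between {n₀ n : ℕ} (hn : n₀ ≤ n) :
    ∃ j : ℕ, 2 ^ j * (n₀ + 1) - 1 ≤ n ∧ n + 1 < 2 ^ (j + 1) * (n₀ + 1) := by
  set q := (n + 1) / (n₀ + 1) with hq
  have hq1 : 1 ≤ q := (Nat.le_div_iff_mul_le (Nat.succ_pos n₀)).2 (by omega)
  refine ⟨Nat.log 2 q, ?_, ?_⟩
  · have h1 : 2 ^ Nat.log 2 q ≤ q := Nat.pow_log_le_self 2 (by omega)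
    have h2 : q * (n₀ + 1) ≤ n + 1 := Nat.div_mul_le_self _ _
    have := Nat.mul_le_mul_right (n₀ + 1) h1
    omega
  · have h1 : q < 2 ^ (Nat.log 2 q + 1) := Nat.lt_pow_succ_log_self (by norm_num) q
    exact (Nat.div_lt_iff_lt_mul (Nat.succ_pos n₀)).1 h1

/-! ### Lemma 39 from the start of the recursion -/

/-- **Lemma 39 (and Remark 40) at `ε`, given the start of the recursion**: if for every `p < 1/2`
with `L = L_ε(p) ≥ 1` one has `324 P_p(LR_𝕋(L, 3L)) ≤ e^{-1}` (`324 = 18²`), then for every `k ≥ 1`,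
`P_p(LR_𝕋(n, k n)) ≤ (k + 2) e^{1/4} e^{-n / (4 L_ε(p))}` for all such `p` and all `n`. [cite: Nolin2008, §7.4 Lemma 39, Remark 40 (arXiv: Lemma 37, Remark 38), proof] -/
theorem Nolin2008_lemma39_at_of_start {ε : ℝ}
    (hstart : ∀ p : unitInterval, (p : ℝ) < 1 / 2 → 1 ≤ charLength ε p →
      324 * triLRCrossingProb p (charLength ε p) (3 * charLength ε p) ≤ Real.exp (-1)) :
    Nolin2008_lemma39_at ε := by
  intro k hk
  refine ⟨(k + 2) * Real.exp (1 / 4), by positivity, 1 / 4, by norm_num, ?_⟩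
  intro p hp hL n
  set L := charLength ε p with hLdef
  have hL1 : (1 : ℝ) ≤ L := by exact_mod_cast hL
  have hLpos : (0 : ℝ) < L := by linarith
  have hP1 : triLRCrossingProb p n (k * n) ≤ 1 := measureReal_le_one
  have hk2 : (1 : ℝ) ≤ k + 2 := by
    have : (0 : ℝ) ≤ k := by positivity
    linarith
  have e1 : (1 : ℝ) ≤ Real.exp (1 / 4) := by linarith [Real.add_one_le_exp (1 / 4 : ℝ)]
  rcases lt_or_ge n L with hnL | hnL
  · -- small `n`: the bound exceeds `1`
    have h1 : (1 : ℝ) ≤ Real.exp (1 / 4) * Real.exp (-(1 / 4 * n / L)) := by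
      rw [← Real.exp_add]
      have : (n : ℝ) / L ≤ 1 := by
        rw [div_le_one hLpos]; exact_mod_cast hnL.le
      have h' : 1 / 4 * (n : ℝ) / L = 1 / 4 * ((n : ℝ) / L) := by ring
      have h'' : (0 : ℝ) ≤ 1 / 4 + -(1 / 4 * n / L) := by rw [h']; linarith
      linarith [Real.add_one_le_exp (1 / 4 + -(1 / 4 * (n : ℝ) / L))]
    calc triLRCrossingProb p n (k * n) ≤ 1 := hP1
      _ ≤ (k + 2 : ℝ) * (Real.exp (1 / 4) * Real.exp (-(1 / 4 * n / L))) :=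
          one_le_mul_of_one_le_of_one_le hk2 h1
      _ = _ := by ring
  · -- `n ≥ L`: the scale `w = n_j ≤ n < n_{j+1}`
    obtain ⟨j, hj1, hj2⟩ := exists_scale_between hnL
    obtain ⟨w, hw⟩ : ∃ w : ℕ, w = 2 ^ j * (L + 1) - 1 := ⟨_, rfl⟩
    rw [← hw] at hj1
    have hw1 : 1 ≤ 2 ^ j * (L + 1) := Nat.one_le_iff_ne_zero.2 (by positivity)
    have hw2 : 2 ^ (j + 1) * (L + 1) = 2 * (w + 1) := by
      have : 2 ^ (j + 1) * (L + 1) = 2 * (2 ^ j * (L + 1)) := by ring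
      omega
    -- the iterated recursion at the scale `w`
    have hrec : ∀ m : ℕ, 324 * triLRCrossingProb p (2 * m + 1) (3 * (2 * m + 1)) ≤
        (324 * triLRCrossingProb p m (3 * m)) ^ 2 := fun m => by
      have := triLRCrossingProb_rec p m
      nlinarith [this, (measureReal_nonneg : 0 ≤ triLRCrossingProb p m (3 * m))]
    have hb : 324 * triLRCrossingProb p w (3 * w) ≤ Real.exp (-2 ^ j) := by
      rw [hw]
      exact sq_iter_le (b := fun m => 324 * triLRCrossingProb p m (3 * m))
        (fun m => mul_nonneg (by norm_num) measureReal_nonneg) hrec (hstart p hp hL) j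
    -- narrowing to the width `w` and covering by bands
    have hn2w : n ≤ 2 * w := by omega
    have hbands : ((k * n / (w + 1) + 1 : ℕ) : ℝ) ≤ 2 * k := by
      have h1 : k * n ≤ k * (2 * w) := Nat.mul_le_mul_left k hn2w
      have h2 : k * (2 * w) < 2 * k * (w + 1) := by nlinarith
      have : k * n / (w + 1) < 2 * k :=
        (Nat.div_lt_iff_lt_mul (by positivity : 0 < w + 1)).2 (by omega)
      exact_mod_cast (show k * n / (w + 1) + 1 ≤ 2 * k by omega)
    have hmain : triLRCrossingProb p n (k * n) ≤ 6 * k * triLRCrossingProb p w (3 * w) := by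
      calc triLRCrossingProb p n (k * n) ≤ triLRCrossingProb p w (k * n) :=
            triLRCrossingProb_anti_width p hj1 _
        _ = (triSitePercolation p).real (triHCross 0 0 w (k * n)) := by
            rw [triLRCrossingProb, triHCross_zero_zero]
        _ ≤ 3 * ((k * n / (w + 1) + 1 : ℕ) : ℝ) * triLRCrossingProb p w (3 * w) :=
            triSitePercolation_real_triHCross_le_bands p 0 w (k * n) le_rfl
        _ ≤ 3 * (2 * k) * triLRCrossingProb p w (3 * w) :=
            mul_le_mul_of_nonneg_right (by linarith [hbands]) measureReal_nonneg
        _ = 6 * k * triLRCrossingProb p w (3 * w) := by ring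
    -- `2^j > n / (4L)`
    have hexp : Real.exp (-2 ^ j) ≤ Real.exp (-(1 / 4 * n / L)) := by
      rw [Real.exp_le_exp, neg_le_neg_iff, div_le_iff₀ hLpos]
      have h1 : ((n : ℝ) + 1) < 2 ^ (j + 1) * ((L : ℝ) + 1) := by exact_mod_cast hj2
      have h2 : (L : ℝ) + 1 ≤ 2 * L := by linarith
      have h3 : (2 : ℝ) ^ (j + 1) = 2 * 2 ^ j := by rw [pow_succ]; ring
      have h4 : (2 : ℝ) ^ (j + 1) * ((L : ℝ) + 1) ≤ 4 * 2 ^ j * L := by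
        rw [h3]; nlinarith [h2, pow_pos (two_pos : (0 : ℝ) < 2) j]
      nlinarith [h1, h4]
    have e2 : 0 ≤ Real.exp (-(1 / 4 * (n : ℝ) / L)) := (Real.exp_pos _).le
    have hk54 : (k : ℝ) / 54 ≤ (k + 2) * Real.exp (1 / 4) := by
      have := mul_le_mul_of_nonneg_left e1 (by positivity : (0 : ℝ) ≤ k + 2)
      have : (0 : ℝ) ≤ k := by positivity
      linarith
    calc triLRCrossingProb p n (k * n) ≤ 6 * k * triLRCrossingProb p w (3 * w) := hmain
      _ = (k : ℝ) / 54 * (324 * triLRCrossingProb p w (3 * w)) := by ring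
      _ ≤ (k : ℝ) / 54 * Real.exp (-2 ^ j) := by gcongr
      _ ≤ (k : ℝ) / 54 * Real.exp (-(1 / 4 * n / L)) := by gcongr
      _ ≤ (k + 2 : ℝ) * Real.exp (1 / 4) * Real.exp (-(1 / 4 * n / L)) :=
          mul_le_mul_of_nonneg_right hk54 e2

/-! ### The start of the recursion from RSW -/

/-- **The start** (Nolin 2008, proof of Lemma 39: "The RSW theory thus entails that for all fixed
`ε₁ > 0`, we can take `ε₀` sufficiently small to get automatically (and independently of `p`)
that `P_p(𝒞_H([0, L] × [0, 2L])) ≤ ε₁`"; here with aspect ratio `3` and `ε₁ = e^{-1}/324`): there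
is `ε₀ > 0` such that for `ε ≤ ε₀`, `p < 1/2` and `L = L_ε(p) ≥ 1`,
`324 P_p(LR_𝕋(L, 3L)) ≤ e^{-1}`. Proof: `P_p(LR_𝕋(L, L)) ≤ ε` (definition of `L_ε`), so by exact
duality the closed sites cross the rhombus with probability `≥ 1 - ε ≥ δ₀`, hence the `3L × L`
parallelogram the long way with probability `≥ 1 - η` (`Nolin2008_RSW_one`, `k = 3`), i.e.
`P_p(LR_𝕋(L, 3L)) ≤ η = e^{-1}/324`. [cite: Nolin2008, §7.4 (proof of Lemma 39; arXiv: Lemma 37), §3.1 Thm. "Russo–Seymour–Welsh" (arXiv: Thm. 2)] -/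
theorem lemma39_start_of_RSW_one (hRSW : Nolin2008_RSW_one) :
    ∃ ε₀ : ℝ, 0 < ε₀ ∧ ∀ ε : ℝ, ε ≤ ε₀ → ∀ p : unitInterval, (p : ℝ) < 1 / 2 →
      1 ≤ charLength ε p →
        324 * triLRCrossingProb p (charLength ε p) (3 * charLength ε p) ≤ Real.exp (-1) := by
  obtain ⟨δ₀, hδ₀, hδ₁, h3⟩ := hRSW 3 (by norm_num) (Real.exp (-1) / 324) (by positivity)
  refine ⟨1 - δ₀, by linarith, fun ε hε p hp hL => ?_⟩
  set L := charLength ε p with hLdef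
  -- `P_p(LR(L, L)) ≤ ε`
  have hne : {n : ℕ | triLRCrossingProb (min p (σ p)) n n ≤ ε}.Nonempty := by
    by_contra h
    rw [Set.not_nonempty_iff_eq_empty] at h
    have : charLength ε p = 0 := by rw [charLength, h, Nat.sInf_empty]
    omega
  have hLL : triLRCrossingProb p L L ≤ ε := by
    have hmin : min p (σ p) = p :=
      min_eq_left (Subtype.coe_le_coe.1 (by rw [unitInterval.coe_symm_eq]; linarith))
    have := triLRCrossingProb_charLength_le hne
    rwa [hmin] at this
  -- the closed sites cross the rhombus with probability `≥ 1 - ε ≥ δ₀`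
  have hdual : δ₀ ≤ triLRCrossingProb (σ p) L L := by
    have := triLRCrossingProb_add_eq_one p L L
    linarith
  -- RSW for the closed sites: the `3L × L` parallelogram the long way
  have hlong : 1 - Real.exp (-1) / 324 ≤ triLRCrossingProb (σ p) (3 * L) L := h3 (σ p) L hL hdual
  -- duality again
  have := triLRCrossingProb_add_eq_one p L (3 * L)
  linarith

/-- **Nolin's Lemma 39 / Remark 40 below the RSW threshold**: there is `ε₀ > 0` such that
`Nolin2008_lemma39_at ε` holds for every `ε ≤ ε₀` (Nolin 2008, proof of Lemma 39: "we have proved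
the property for any `ε` below some fixed value `ε₀` (given by RSW)"). [cite: Nolin2008, §7.4 Lemma 39 and Remark 40 (arXiv 0711.4948: Lemma 37, Remark 38)] -/
theorem Nolin2008_lemma39_at_of_RSW_one (hRSW : Nolin2008_RSW_one) :
    ∃ ε₀ : ℝ, 0 < ε₀ ∧ ∀ ε : ℝ, ε ≤ ε₀ → Nolin2008_lemma39_at ε := by
  obtain ⟨ε₀, hε₀, h⟩ := lemma39_start_of_RSW_one hRSW
  exact ⟨ε₀, hε₀, fun ε hε => Nolin2008_lemma39_at_of_start (h ε hε)⟩

/-! ### Comparison with the tree's `Nolin2008_lemma39` (every `ε ∈ (0, 1/2)`) -/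

/-- `P_p(LR_𝕋(0, 0)) ≤ p`: the single-site parallelogram `[0, 0]²` is crossed only if the origin is
open. [folklore] -/
theorem triLRCrossingProb_zero_zero_le (p : unitInterval) : triLRCrossingProb p 0 0 ≤ (p : ℝ) := by
  unfold triLRCrossingProb
  calc (triSitePercolation p).real (triLRCrossing 0 0)
      ≤ (triSitePercolation p).real {ω : SiteConfig (Site 2) | (0 : Site 2) ∈ ω} := by
        refine measureReal_mono (fun ω hω => ?_) (measure_ne_top _ _)
        obtain ⟨x, hx, y, -, hω⟩ := mem_triLRCrossing_iff.1 hω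
        have hx' := mem_rectangle_iff.1 (Finset.mem_filter.1 hx).1
        push_cast at hx'
        have h0 : x 0 = 0 := by omega
        have h1 : x 1 = 0 := by omega
        have hx0 : x = 0 := by
          ext i; fin_cases i
          · simpa using h0
          · simpa using h1
        subst hx0
        exact hω.1
    _ = p := by rw [triSitePercolation, sitePercolation_real_mem]

/-- **The tree's `Nolin2008_lemma39` implies `Nolin2008_lemma39_at ε` for every `ε ∈ (0, 1/2)`.**
The tree's statement (`NearCriticalArm.lean`) guards by `ε < p` and `n ≥ 1`; the present one by
`1 ≤ L_ε(p)` and allows `n = 0`. If `1 ≤ L_ε(p)` then `ε < p` (for `p ≤ ε` the single-site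
parallelogram is crossed with probability `p ≤ ε`, so `L_ε(p) = 0`), and the case `n = 0` holds
with the constant `max C₁ 1`. [cite: Nolin2008, §7.4 Lemma 39 and Remark 40 (arXiv 0711.4948: Lemma 37, Remark 38)] -/
theorem Nolin2008_lemma39_at_of_lemma39 (h : Nolin2008_lemma39) {ε : ℝ} (hε : 0 < ε)
    (hε' : ε < 1 / 2) : Nolin2008_lemma39_at ε := by
  intro k hk
  obtain ⟨C₁, hC₁, C₂, hC₂, hb⟩ := h hε hε' k hk
  refine ⟨max C₁ 1, by positivity, C₂, hC₂, fun p hp hL n => ?_⟩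
  have hεp : ε < (p : ℝ) := by
    by_contra hle
    push Not at hle
    have hmin : min p (σ p) = p :=
      min_eq_left (Subtype.coe_le_coe.1 (by rw [unitInterval.coe_symm_eq]; linarith))
    have h0 : (0 : ℕ) ∈ {n : ℕ | triLRCrossingProb (min p (σ p)) n n ≤ ε} := by
      rw [Set.mem_setOf_eq, hmin]
      exact (triLRCrossingProb_zero_zero_le p).trans hle
    have : charLength ε p = 0 := Nat.eq_zero_of_le_zero (Nat.sInf_le h0)
    omega
  rcases Nat.eq_zero_or_pos n with rfl | hn
  · calc triLRCrossingProb p 0 (k * 0) ≤ 1 := measureReal_le_one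
      _ ≤ max C₁ 1 * Real.exp (-(C₂ * ((0 : ℕ) : ℝ) / charLength ε p)) := by
          simp only [Nat.cast_zero, mul_zero, zero_div, neg_zero, Real.exp_zero, mul_one]
          exact le_max_right _ _
  · calc triLRCrossingProb p n (k * n) ≤ C₁ * Real.exp (-(C₂ * n / charLength ε p)) :=
          hb p hεp hp n hn
      _ ≤ max C₁ 1 * Real.exp (-(C₂ * n / charLength ε p)) :=
          mul_le_mul_of_nonneg_right (le_max_left _ _) (Real.exp_pos _).le

/-! ### Assembly: `ν = 4/3` from the four-arm exponent, Kesten's relation and RSW -/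

/-- **The correlation-length exponent from three named inputs and RSW.**
`triCorrLength_exponent` (`ξ(p) = |p - 1/2|^{-4/3 + o(1)}` for the radius-of-the-finite-cluster
correlation length of site percolation on `𝕋`) follows from the four-arm exponent
`fourArm_exponent` (Smirnov–Werner 2001), Kesten's scaling relation `Nolin2008_prop34`
(`KestenScaling.lean`) and the Russo–Seymour–Welsh theorem in the two forms `Nolin2008_RSW`,
`Nolin2008_RSW_one` (Nolin 2008, §3.1 [arXiv: Thm. 2]): take `ε = min ε₀ (1/4)` in
`triCorrLength_exponent_of_RSW_lemma39_at'`. [cite: Nolin2008, §7.2 Thm. "Critical exponents" (arXiv: Thm. 31), §7.4 Lemma 39 (arXiv: Lemma 37)] [cite: SmirnovWernerMRL2001, Thm. 2 (iii)-(iv) (arXiv math/0109120: Thm. 1 (iii)-(iv))] -/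
theorem triCorrLength_exponent_of_RSW_one (h₄ : fourArm_exponent) (hK : Nolin2008_prop34)
    (hRSW : Nolin2008_RSW) (hRSW1 : Nolin2008_RSW_one) : triCorrLength_exponent := by
  obtain ⟨ε₀, hε₀, h37⟩ := Nolin2008_lemma39_at_of_RSW_one hRSW1
  exact triCorrLength_exponent_of_RSW_lemma39_at' h₄ hK hRSW (ε := min ε₀ (1 / 4))
    (lt_min hε₀ (by norm_num)) (lt_of_le_of_lt (min_le_right _ _) (by norm_num))
    (h37 _ (min_le_left _ _))

/-- **The same from Nolin's RSW theorem as printed** (`Nolin2008_RSW_thm`, the functions `f_k`):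
`fourArm_exponent → Nolin2008_prop34 → Nolin2008_RSW_thm → triCorrLength_exponent`. [cite: Nolin2008, §3.1 Thm. "Russo–Seymour–Welsh" (arXiv: Thm. 2), §7.2 Thm. "Critical exponents" (arXiv: Thm. 31), §7.4 Lemma 39 (arXiv: Lemma 37)] -/
theorem triCorrLength_exponent_of_RSW_thm (h₄ : fourArm_exponent) (hK : Nolin2008_prop34)
    (h2 : Nolin2008_RSW_thm) : triCorrLength_exponent :=
  triCorrLength_exponent_of_RSW_one h₄ hK (Nolin2008_RSW_of_RSW_thm h2) (Nolin2008_RSW_one_of_RSW_thm h2)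

/-- **`ν = 4/3` from the tree's uniform exponential decay** (`Nolin2008_lemma39`,
`NearCriticalArm.lean`, every `ε ∈ (0, 1/2)`) instead of `Nolin2008_RSW_one`, at `ε = 1/4`. [cite: Nolin2008, §7.2 Thm. "Critical exponents" (arXiv: Thm. 31), §7.4 Lemma 39 (arXiv: Lemma 37)] -/
theorem triCorrLength_exponent_of_RSW_lemma39 (h₄ : fourArm_exponent) (hK : Nolin2008_prop34)
    (hRSW : Nolin2008_RSW) (h39 : Nolin2008_lemma39) : triCorrLength_exponent :=
  triCorrLength_exponent_of_RSW_lemma39_at' h₄ hK hRSW (ε := 1 / 4) (by norm_num) (by norm_num)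
    (Nolin2008_lemma39_at_of_lemma39 h39 (by norm_num) (by norm_num))

end Literature.Probability.Percolation
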